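import Literature.NumberTheory.EllipticCurves.ComplexMultiplicationSingularModuliProofs
import Literature.NumberTheory.EllipticCurves.ComplexMultiplicationSingularModuliNonmaximal
import Literature.NumberTheory.EllipticCurves.SingularModuliConjugate
import Literature.NumberTheory.EllipticCurves.SingularModuliWeberCubeRootInert
import Literature.NumberTheory.EllipticCurves.ComplexMultiplicationHasCMTwoLeavesProofs
import Literature.NumberTheory.EllipticCurves.SingularModuliIntegral
import Literature.NumberTheory.EllipticCurves.ModularPolynomialDegY
import Literature.NumberTheory.EllipticCurves.ComplexMultiplicationClassPolynomialRootProofs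
import Literature.NumberTheory.EllipticCurves.SingularModuliCubeSquareAwayFromSix
import HarnessLib

/-!
# The modular equation of level 3 is symmetric: `Φ₃(X, Y) = Φ₃(Y, X)` (Cox, Thm. 11.18 (ii), `m = 3`)

Topic `NumberTheory/EllipticCurves` (complex multiplication).  Theorem-only file (no definition, no named
fact): for the tree's integer modular equation `intModularPolynomial 3 ∈ ℤ[Y][X]`
(`ModularPolynomialIntegral.lean`; characterised by `Φ₃(X, j(τ)) = ∏_{σ ∈ C(3)} (X − j(στ))`, Cox,
*Primes of the form x² + ny²*, 2nd ed., §11.B (11.14)–(11.15), §11.C Thm. 11.18), we prove the symmetry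

  `((intModularPolynomial 3).coeff m).coeff n = ((intModularPolynomial 3).coeff n).coeff m`   (all `m, n`),

i.e. `Φ₃(X, Y) = Φ₃(Y, X)` — Cox Thm. 11.18 (ii): "`Φ_m(X, Y) = Φ_m(Y, X)` if `m > 1`" — and its pointwise form
`Φ₃(x, y) = Φ₃(y, x)` for all complex `x, y` (`intModularPolynomial_three_eval_symm`).  Cox proves (ii)
from the irreducibility of `Φ_m(X, j(τ))` over `ℂ(j(τ))` (Thm. 11.18 proof, PDF pp. 233–234); the tree has
the fibre product and the pointwise relations `Φ₃(j(3τ), j(τ)) = 0 = Φ₃(j((τ+k)/3), j(τ))` but neither the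
irreducibility nor the symmetry.  Here is an irreducibility-free proof BY COMPLEX MULTIPLICATION:

## Method

1. *Shape.* `Φ₃ = X⁴ + Σ_{m ≤ 3, n ≤ 4} κ_{mn} Yⁿ Xᵐ` with `deg_Y κ_m ≤ 3` for `m ≥ 1`, `≤ 4` for `m = 0`,
   `κ₃₃ = −1` (the tree's shape theorems).  So the "column" `x ↦ Φ₃(y₀, x)` is a polynomial of degree `≤ 4`
   with `x⁴`-coefficient `κ₀₄`.
2. *Columns at five CM points.* For `τ₀ = τ_{(1,1,c₀)}`, `c₀ ∈ {2, 5, 11, 17, 41}` (discriminants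
   `d = −7, −19, −43, −67, −163`, class number one, `3` INERT), the four level-3 conjugates `3τ₀`, `τ₀/3`,
   `(τ₀+1)/3`, `(τ₀+2)/3` are CM points of discriminant `9d` landing in FOUR DISTINCT reduced forms (the four
   classes of the order of conductor `3`), so their moduli `r₀, …, r₃` are pairwise distinct
   (`formJ_injOn_reducedForms`, Cox Thm. 11.2 with Thm. 2.8).  The fibre is `Φ₃(x, y₀) = ∏ (x − rᵢ)`
   (`y₀ = j(τ₀)`), and the REVERSED relations `Φ₃(y₀, rᵢ) = 0` hold pointwise (`τ₀ = (3τ₀)/3`,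
   `j(3·((τ₀+k)/3)) = j(τ₀ + k) = j(τ₀)`).  A polynomial of degree `≤ 4` with leading coefficient `κ₀₄` and
   four distinct roots `rᵢ` is `κ₀₄ ∏ (x − rᵢ)`; hence `Φ₃(y₀, x) = κ₀₄ · Φ₃(x, y₀)` for all `x`.
3. *Globalisation.* For fixed `x`, `y ↦ Φ₃(y, x) − κ₀₄ Φ₃(x, y)` has degree `≤ 4` in `y` and vanishes at the
   five distinct values `y₀ = −3375, −884736, −884736000, −147197952000, −262537412640768000`
   (Cox (12.20)); so it vanishes identically, and comparing coefficients `κ_{nm} = κ₀₄ κ_{mn}`; at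
   `(m, n) = (3, 3)`: `κ₀₄ = 1`.

## References

* [Cox2013] D. A. Cox, *Primes of the form x² + ny²*, 2nd ed. (2013): §11.C Thm. 11.18 (ii) (symmetry),
  §11.B (11.14)–(11.15) (the fibre), §11.A Thm. 11.2 / §2.A Thm. 2.8 (`j` separates reduced forms),
  §7 (orders of conductor `3`), §12.C (12.20) (the five singular moduli).
-/

noncomputable section

open Complex Polynomial
open UpperHalfPlane hiding I
open scoped MatrixGroups

namespace Literature.NumberTheory.EllipticCurves

open ModularForms
open Literature.NumberTheory.QuadraticFields.Quadratic (BinQF)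
open Literature.NumberTheory.QuadraticFields.BinaryQuadraticForm (mem_reducedForms_iff discr IsPrimitive IsReduced)

namespace ModularPolynomialThree

/-! ### §0 The five class-number-one values used (Cox (12.20)), re-derived here so that this file depends
on built modules only (the same values are anchor theorems of `GrossZagierSingularModuliClassNumberOne.lean`) -/

open Literature.NumberTheory.QuadraticFields.BinaryQuadraticForm (principalForm classNumberOneDiscrs) in
/-- `j(τ_P) = j(𝒪_D)` (the tabulated singular modulus) at the principal form of a class-number-one `D`.
[cite: Cox2013, §12.C table (12.20)] -/
private theorem kleinJ_heegnerTau_principalForm {D : ℤ} (hD : D ∈ classNumberOneDiscrs) :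
    kleinJ (heegnerTau (principalForm D)) = ((singularModulus D : ℚ) : ℂ) := by
  have h : D < 0 ∧ (D % 4 = 0 ∨ D % 4 = 1) := by
    have hD' := hD
    simp only [classNumberOneDiscrs, Finset.mem_insert, Finset.mem_singleton] at hD'
    rcases hD' with rfl | rfl | rfl | rfl | rfl | rfl | rfl | rfl | rfl | rfl | rfl | rfl | rfl <;>
      norm_num
  rw [kleinJ_eq_periodPair_j, ← formJ_def, formJ_principalForm h.1 h.2,
    j_cmPeriodPair_eq_singularModulus singularModuli_classNumberOne_holds
      singularModuli_nonmaximalOrders_holds hD]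

open Literature.NumberTheory.QuadraticFields.BinaryQuadraticForm (principalForm) in
/-- `j((−1 + √−7)/2) = −3375`. [cite: Cox2013, §12.C table (12.20)] -/
private theorem kleinJ_heegnerTau_neg_seven : kleinJ (heegnerTau (1, 1, 2)) = -3375 := by
  have h := kleinJ_heegnerTau_principalForm (D := -7) (by decide)
  rw [show principalForm (-7) = (1, 1, 2) by decide] at h
  rw [h]; norm_num [singularModulus]

open Literature.NumberTheory.QuadraticFields.BinaryQuadraticForm (principalForm) in
/-- `j((−1 + √−19)/2) = −884736`. [cite: Cox2013, §12.C table (12.20)] -/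
private theorem kleinJ_heegnerTau_neg_nineteen : kleinJ (heegnerTau (1, 1, 5)) = -884736 := by
  have h := kleinJ_heegnerTau_principalForm (D := -19) (by decide)
  rw [show principalForm (-19) = (1, 1, 5) by decide] at h
  rw [h]; norm_num [singularModulus]

open Literature.NumberTheory.QuadraticFields.BinaryQuadraticForm (principalForm) in
/-- `j((−1 + √−43)/2) = −884736000`. [cite: Cox2013, §12.C table (12.20)] -/
private theorem kleinJ_heegnerTau_neg_fortyThree : kleinJ (heegnerTau (1, 1, 11)) = -884736000 := by
  have h := kleinJ_heegnerTau_principalForm (D := -43) (by decide)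
  rw [show principalForm (-43) = (1, 1, 11) by decide] at h
  rw [h]; norm_num [singularModulus]

open Literature.NumberTheory.QuadraticFields.BinaryQuadraticForm (principalForm) in
/-- `j((−1 + √−67)/2) = −147197952000`. [cite: Cox2013, §12.C table (12.20)] -/
private theorem kleinJ_heegnerTau_neg_sixtySeven : kleinJ (heegnerTau (1, 1, 17)) = -147197952000 := by
  have h := kleinJ_heegnerTau_principalForm (D := -67) (by decide)
  rw [show principalForm (-67) = (1, 1, 17) by decide] at h
  rw [h]; norm_num [singularModulus]

open Literature.NumberTheory.QuadraticFields.BinaryQuadraticForm (principalForm) in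
/-- `j((−1 + √−163)/2) = −262537412640768000`. [cite: Cox2013, §12.C table (12.20)] -/
private theorem kleinJ_heegnerTau_neg_oneSixtyThree :
    kleinJ (heegnerTau (1, 1, 41)) = -262537412640768000 := by
  have h := kleinJ_heegnerTau_principalForm (D := -163) (by decide)
  rw [show principalForm (-163) = (1, 1, 41) by decide] at h
  rw [h]; norm_num [singularModulus]


/-! ### §1 The shape of `Φ₃ ∈ ℤ[Y][X]` -/

/-- `Φ₃` has degree `4` in `X`. [cite: Cox2013, §11.B after (11.15)] -/
theorem natDegree_eq : (intModularPolynomial 3).natDegree = 4 := natDegree_intModularPolynomial 3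

/-- The coefficient of `X⁴` is `1`. [cite: Cox2013, §11.B after (11.15)] -/
theorem coeff_four : (intModularPolynomial 3).coeff 4 = 1 := coeff_intModularPolynomial_natDegree_succ 3

/-- Every coefficient of `Φ₃` has degree `≤ 4` in `Y`. [cite: Cox2013, §11.C Thm. 11.18(iii)] -/
theorem natDegree_coeff_le (m : ℕ) : ((intModularPolynomial 3).coeff m).natDegree ≤ 4 :=
  natDegree_coeff_intModularPolynomial_le 3 m

/-- The coefficients of `X¹, X², X³` have degree `≤ 3` in `Y`. [cite: Cox2013, §11.C Thm. 11.18(iii)] -/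
theorem natDegree_coeff_le_three {m : ℕ} (hm : 1 ≤ m) : ((intModularPolynomial 3).coeff m).natDegree ≤ 3 :=
  natDegree_coeff_intModularPolynomial_le_of_pos 3 hm

/-- The coefficient of `X³Y³` is `−1`. [cite: Cox2013, §11.C Thm. 11.18(iv)] -/
theorem coeff_three_three : ((intModularPolynomial 3).coeff 3).coeff 3 = -1 :=
  coeff_coeff_intModularPolynomial_self 3

/-- The coefficients of `XᵐY⁴`, `m ≥ 1`, vanish. [cite: Cox2013, §11.C Thm. 11.18(iii)] -/
theorem coeff_coeff_four_of_pos {m : ℕ} (hm : 1 ≤ m) : ((intModularPolynomial 3).coeff m).coeff 4 = 0 :=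
  coeff_eq_zero_of_natDegree_lt (lt_of_le_of_lt (natDegree_coeff_le_three hm) (by norm_num))

/-- The coefficient of `X⁴` is the constant `1`: its `Y`-coefficients. [cite: Cox2013, §11.B after (11.15)] -/
theorem coeff_four_coeff (i : ℕ) : ((intModularPolynomial 3).coeff 4).coeff i = if i = 0 then 1 else 0 := by
  rw [coeff_four, coeff_one]

/-- Coefficients of `Xᵐ`, `m ≥ 5`, vanish. [cite: Cox2013, §11.B after (11.15)] -/
theorem coeff_eq_zero_of_five_le {m : ℕ} (hm : 5 ≤ m) : (intModularPolynomial 3).coeff m = 0 :=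
  coeff_eq_zero_of_natDegree_lt (by rw [natDegree_eq]; omega)

/-- Coefficients of `XᵐYⁿ`, `n ≥ 5`, vanish. [cite: Cox2013, §11.C Thm. 11.18(iii)] -/
theorem coeff_coeff_eq_zero_of_five_le (m : ℕ) {n : ℕ} (hn : 5 ≤ n) :
    ((intModularPolynomial 3).coeff m).coeff n = 0 :=
  coeff_eq_zero_of_natDegree_lt (lt_of_le_of_lt (natDegree_coeff_le m) (by omega))

/-! ### §2 `Φ₃(x, y)` over `ℂ` as an explicit double sum / quartic in either variable -/

/-- `Φ₃(x, y) = Σ_{m<5} (Σ_{n<5} κ_{m,n} yⁿ) xᵐ` over `ℂ`. [cite: Cox2013, §11.C Thm. 11.18(i),(iii)] -/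
theorem eval_eq_sum (x y : ℂ) :
    (((intModularPolynomial 3).map (mapRingHom (Int.castRingHom ℂ))).map (evalRingHom y)).eval x =
      ∑ m ∈ Finset.range 5, (∑ n ∈ Finset.range 5,
        ((((intModularPolynomial 3).coeff m).coeff n : ℤ) : ℂ) * y ^ n) * x ^ m := by
  have hdeg : (((intModularPolynomial 3).map (mapRingHom (Int.castRingHom ℂ))).map
      (evalRingHom y)).natDegree < 5 :=
    lt_of_le_of_lt (natDegree_map_le.trans (natDegree_map_le.trans natDegree_eq.le)) (by norm_num)
  rw [eval_eq_sum_range' hdeg]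
  refine Finset.sum_congr rfl fun m _ => ?_
  congr 1
  rw [coeff_map, coeff_map, coe_mapRingHom, coe_evalRingHom]
  have hdeg' : (((intModularPolynomial 3).coeff m).map (Int.castRingHom ℂ)).natDegree < 5 :=
    lt_of_le_of_lt (natDegree_map_le.trans (natDegree_coeff_le m)) (by norm_num)
  rw [eval_eq_sum_range' hdeg']
  refine Finset.sum_congr rfl fun i _ => ?_
  rw [coeff_map, eq_intCast]

/-- `Φ₃(x, y)` as an explicit quartic in `x` (rows), with the known coefficients `κ_{4,n}` and
`κ_{m,4} = 0` (`m ≥ 1`) substituted. [cite: Cox2013, §11.C Thm. 11.18] -/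
theorem eval_eq_quartic (x y : ℂ) :
    (((intModularPolynomial 3).map (mapRingHom (Int.castRingHom ℂ))).map (evalRingHom y)).eval x =
      x ^ 4 +
      ((((intModularPolynomial 3).coeff 3).coeff 0 : ℂ) + (((intModularPolynomial 3).coeff 3).coeff 1 : ℂ) * y +
          (((intModularPolynomial 3).coeff 3).coeff 2 : ℂ) * y ^ 2 + (((intModularPolynomial 3).coeff 3).coeff 3 : ℂ) * y ^ 3) * x ^ 3 +
      ((((intModularPolynomial 3).coeff 2).coeff 0 : ℂ) + (((intModularPolynomial 3).coeff 2).coeff 1 : ℂ) * y +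
          (((intModularPolynomial 3).coeff 2).coeff 2 : ℂ) * y ^ 2 + (((intModularPolynomial 3).coeff 2).coeff 3 : ℂ) * y ^ 3) * x ^ 2 +
      ((((intModularPolynomial 3).coeff 1).coeff 0 : ℂ) + (((intModularPolynomial 3).coeff 1).coeff 1 : ℂ) * y +
          (((intModularPolynomial 3).coeff 1).coeff 2 : ℂ) * y ^ 2 + (((intModularPolynomial 3).coeff 1).coeff 3 : ℂ) * y ^ 3) * x +
      ((((intModularPolynomial 3).coeff 0).coeff 0 : ℂ) + (((intModularPolynomial 3).coeff 0).coeff 1 : ℂ) * y +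
          (((intModularPolynomial 3).coeff 0).coeff 2 : ℂ) * y ^ 2 + (((intModularPolynomial 3).coeff 0).coeff 3 : ℂ) * y ^ 3 +
          (((intModularPolynomial 3).coeff 0).coeff 4 : ℂ) * y ^ 4) := by
  rw [eval_eq_sum]
  simp only [Finset.sum_range_succ, Finset.sum_range_zero, coeff_four_coeff,
    coeff_coeff_four_of_pos (show 1 ≤ 1 by norm_num), coeff_coeff_four_of_pos (show 1 ≤ 2 by norm_num),
    coeff_coeff_four_of_pos (show 1 ≤ 3 by norm_num)]
  push_cast
  ring

/-! ### §3 The fibre `Φ₃(x, j(τ)) = ∏_σ (x − j(στ))` and the reversed relations `Φ₃(j(τ), j(στ)) = 0` -/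

/-- **The fibre identity at level 3**: `Φ₃(x, j(τ)) = (x − j(3τ))(x − j(τ/3))(x − j((τ+1)/3))(x − j((τ+2)/3))`.
[cite: Cox2013, §11.B (11.14)–(11.15)] -/
theorem eval_kleinJ_eq_prod (x : ℂ) (τ : ℍ) :
    (((intModularPolynomial 3).map (mapRingHom (Int.castRingHom ℂ))).map (evalRingHom (kleinJ τ))).eval x =
      (x - kleinJ (mulPoint 3 τ)) * ((x - kleinJ (divPoint 3 0 τ)) * ((x - kleinJ (divPoint 3 1 τ)) *
        (x - kleinJ (divPoint 3 2 τ)))) := by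
  rw [map_intModularPolynomial, eval_map_kleinJ_modularPolynomial, Fintype.prod_option]
  have h3 : ∏ k : ZMod 3, (x - jConj (some k) τ) =
      (x - jConj (some (0 : ZMod 3)) τ) * ((x - jConj (some (1 : ZMod 3)) τ) * (x - jConj (some (2 : ZMod 3)) τ)) := by
    have h : ∏ k : ZMod 3, (x - jConj (some k) τ) =
        (x - jConj (some (0 : ZMod 3)) τ) * (x - jConj (some (1 : ZMod 3)) τ) * (x - jConj (some (2 : ZMod 3)) τ) :=
      Fin.prod_univ_three (fun k : ZMod 3 => x - jConj (some k) τ)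
    rw [h, mul_assoc]
  rw [h3, jConj_none, jConj_some_eq_of_intCast_eq (k := (0 : ZMod 3)) (k' := 0) (by simp),
    jConj_some_eq_of_intCast_eq (k := (1 : ZMod 3)) (k' := 1) (by simp),
    jConj_some_eq_of_intCast_eq (k := (2 : ZMod 3)) (k' := 2) (by simp)]

/-- `(3τ)/3 = τ`. [folklore] -/
private theorem divPoint_three_zero_mulPoint (τ : ℍ) : divPoint 3 0 (mulPoint 3 τ) = τ := by
  apply UpperHalfPlane.ext
  rw [coe_divPoint, coe_mulPoint]
  push_cast
  ring

/-- `j(3 · (τ + k)/3) = j(τ + k) = j(τ)`. [cite: Cox2013, §11.A Thm. 11.2] -/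
theorem kleinJ_mulPoint_divPoint (k : ℤ) (τ : ℍ) : kleinJ (mulPoint 3 (divPoint 3 k τ)) = kleinJ τ := by
  have e : mulPoint 3 (divPoint 3 k τ) = ModularGroup.T ^ k • τ := by
    apply UpperHalfPlane.ext
    rw [coe_mulPoint, coe_divPoint, UpperHalfPlane.modular_T_zpow_smul, UpperHalfPlane.coe_vadd]
    push_cast
    ring
  rw [e, kleinJ_smul]

/-- **Reversed relation** `Φ₃(j(τ), j(3τ)) = 0` (since `τ = (3τ)/3`). [cite: Cox2013, §11.B (11.15)] -/
theorem eval_kleinJ_kleinJ_mulPoint (τ : ℍ) :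
    (((intModularPolynomial 3).map (mapRingHom (Int.castRingHom ℂ))).map
      (evalRingHom (kleinJ (mulPoint 3 τ)))).eval (kleinJ τ) = 0 := by
  have h := intModularPolynomial_kleinJ_divPoint 3 0 (mulPoint 3 τ)
  rwa [divPoint_three_zero_mulPoint] at h

/-- **Reversed relation** `Φ₃(j(τ), j((τ + k)/3)) = 0` (since `3·(τ+k)/3 = τ + k`). [cite: Cox2013, §11.B after (11.15)] -/
theorem eval_kleinJ_kleinJ_divPoint (k : ℤ) (τ : ℍ) :
    (((intModularPolynomial 3).map (mapRingHom (Int.castRingHom ℂ))).map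
      (evalRingHom (kleinJ (divPoint 3 k τ)))).eval (kleinJ τ) = 0 := by
  have h := intModularPolynomial_kleinJ_mulPoint 3 (divPoint 3 k τ)
  rwa [kleinJ_mulPoint_divPoint] at h

/-! ### §4 Algebra: quartics with four distinct roots; coefficients from values -/

/-- A polynomial function of degree `≤ 4` with leading coefficient `c₄` vanishing at four distinct points
`r₀, r₁, r₂, r₃` is `c₄ ∏ (x − rᵢ)`. [folklore] -/
private theorem quartic_eq_mul_prod {c₀ c₁ c₂ c₃ c₄ r₀ r₁ r₂ r₃ : ℂ} (h01 : r₀ ≠ r₁) (h02 : r₀ ≠ r₂) (h03 : r₀ ≠ r₃)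
    (h12 : r₁ ≠ r₂) (h13 : r₁ ≠ r₃) (h23 : r₂ ≠ r₃)
    (h : ∀ r ∈ ({r₀, r₁, r₂, r₃} : Finset ℂ), c₄ * r ^ 4 + c₃ * r ^ 3 + c₂ * r ^ 2 + c₁ * r + c₀ = 0) (x : ℂ) :
    c₄ * x ^ 4 + c₃ * x ^ 3 + c₂ * x ^ 2 + c₁ * x + c₀ = c₄ * ((x - r₀) * ((x - r₁) * ((x - r₂) * (x - r₃)))) := by
  -- the difference is a cubic
  set d : ℂ[X] := C (c₃ + c₄ * (r₀ + r₁ + r₂ + r₃)) * X ^ 3 +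
      C (c₂ - c₄ * (r₀ * r₁ + r₀ * r₂ + r₀ * r₃ + r₁ * r₂ + r₁ * r₃ + r₂ * r₃)) * X ^ 2 +
      C (c₁ + c₄ * (r₀ * r₁ * r₂ + r₀ * r₁ * r₃ + r₀ * r₂ * r₃ + r₁ * r₂ * r₃)) * X +
      C (c₀ - c₄ * (r₀ * r₁ * r₂ * r₃)) with hd_def
  have hd : ∀ z, d.eval z = (c₄ * z ^ 4 + c₃ * z ^ 3 + c₂ * z ^ 2 + c₁ * z + c₀) -
      c₄ * ((z - r₀) * ((z - r₁) * ((z - r₂) * (z - r₃)))) := by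
    intro z
    simp only [hd_def, eval_add, eval_mul, eval_pow, eval_C, eval_X]
    ring
  have hcard : ({r₀, r₁, r₂, r₃} : Finset ℂ).card = 4 := by
    rw [Finset.card_insert_of_notMem (by simp [h01, h02, h03]), Finset.card_insert_of_notMem (by simp [h12, h13]),
      Finset.card_pair h23]
  have hzero : d = 0 := by
    refine eq_zero_of_natDegree_lt_card_of_eval_eq_zero' d {r₀, r₁, r₂, r₃} (fun r hr => ?_) ?_
    · rw [hd, h r hr]
      simp only [Finset.mem_insert, Finset.mem_singleton] at hr
      rcases hr with rfl | rfl | rfl | rfl <;> ring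
    · rw [hcard]; exact lt_of_le_of_lt natDegree_cubic_le (by norm_num)
  have := hd x
  rw [hzero, eval_zero] at this
  linear_combination -this

/-- If `Σ_{n<N} e n · yᵢⁿ = 0` at `N` distinct points `yᵢ` then every `e n`, `n < N`, vanishes. [folklore] -/
private theorem coeff_eq_zero_of_sum_eq_zero {N : ℕ} (e : ℕ → ℂ) (s : Finset ℂ) (hs : N ≤ s.card)
    (h : ∀ y ∈ s, ∑ n ∈ Finset.range N, e n * y ^ n = 0) : ∀ n < N, e n = 0 := by
  intro n hn
  set p : ℂ[X] := ∑ k ∈ Finset.range N, C (e k) * X ^ k with hp_def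
  have hp : ∀ z, p.eval z = ∑ k ∈ Finset.range N, e k * z ^ k := by
    intro z; simp [hp_def, eval_finsetSum]
  have hdeg' : p.natDegree ≤ N - 1 := natDegree_sum_le_of_forall_le _ _ (fun k hk =>
    (natDegree_C_mul_X_pow_le (e k) k).trans (Nat.le_sub_one_of_lt (Finset.mem_range.mp hk)))
  have hdeg : p.natDegree < s.card := by omega
  have hzero : p = 0 := eq_zero_of_natDegree_lt_card_of_eval_eq_zero' p s (fun y hy => by rw [hp, h y hy]) hdeg
  have hc := congr_arg (fun q : ℂ[X] => q.coeff n) hzero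
  simp only [hp_def, finsetSum_coeff, coeff_C_mul_X_pow, coeff_zero] at hc
  rw [Finset.sum_eq_single n (fun k _ hk => if_neg (Ne.symm hk)) (fun h' => absurd (Finset.mem_range.mpr hn) h')] at hc
  simpa using hc

/-! ### §5 The level-3 conjugates of a CM point, as forms -/

/-- `3τ_{(a,b,c)} = τ_{(a, 3b, 9c)}` (the sublattice `[1, 3τ]`). [cite: Cox2013, §11.B Lemma 11.24 (cyclic sublattices `d[1, στ]`, `σ ∈ C(3)`)] -/
theorem mulPoint_three_heegnerTau_of_pos {a b c : ℤ} (ha : 0 < a) (hD : b ^ 2 - 4 * a * c < 0) :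
    mulPoint 3 (heegnerTau (a, b, c)) = heegnerTau (a, 3 * b, 9 * c) := by
  have ha0 : (a : ℂ) ≠ 0 := by exact_mod_cast ha.ne'
  apply UpperHalfPlane.ext
  rw [coe_mulPoint, coe_heegnerTau_eq (Q := (a, b, c)) (D := b ^ 2 - 4 * a * c) ha rfl hD,
    coe_heegnerTau_eq (Q := (a, 3 * b, 9 * c)) (D := 9 * (b ^ 2 - 4 * a * c)) ha (by push_cast; ring)
      (by linarith), sqrtDisc_nine_mul]
  push_cast
  ring

/-- `(τ_{(a,b,c)} + k)/3 = τ_{(9a, 3(b − 2ak), ak² − bk + c)}` (the sublattices `3[1, (τ + k)/3]`). [cite: Cox2013, §11.B Lemma 11.24 (cyclic sublattices `d[1, στ]`, `σ ∈ C(3)`)] -/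
theorem divPoint_three_heegnerTau_of_pos {a b c : ℤ} (ha : 0 < a) (hD : b ^ 2 - 4 * a * c < 0) (k : ℤ) :
    divPoint 3 k (heegnerTau (a, b, c)) = heegnerTau (9 * a, 3 * (b - 2 * a * k), a * k ^ 2 - b * k + c) := by
  have ha0 : (a : ℂ) ≠ 0 := by exact_mod_cast ha.ne'
  apply UpperHalfPlane.ext
  rw [coe_divPoint, coe_heegnerTau_eq (Q := (a, b, c)) (D := b ^ 2 - 4 * a * c) ha rfl hD,
    coe_heegnerTau_eq (Q := (9 * a, 3 * (b - 2 * a * k), a * k ^ 2 - b * k + c)) (D := 9 * (b ^ 2 - 4 * a * c))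
      (by linarith) (by push_cast; ring) (by linarith), sqrtDisc_nine_mul]
  push_cast
  field_simp
  ring

/-- **`j` separates reduced forms**: two distinct primitive reduced positive definite forms of the same
discriminant have distinct `j`-invariants (stated on the defining conditions, so that no concrete
`reducedForms D` is ever unfolded by the elaborator). [cite: Cox2013, §11.A Thm. 11.2 and §2.A Thm. 2.8] -/
theorem formJ_ne_of_reduced {D : ℤ} (hD : D < 0) {Q Q' : ℤ × ℤ × ℤ}
    (hQ : discr Q = D ∧ 0 < Q.1 ∧ IsPrimitive Q ∧ IsReduced Q)
    (hQ' : discr Q' = D ∧ 0 < Q'.1 ∧ IsPrimitive Q' ∧ IsReduced Q') (h : Q ≠ Q') :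
    formJ Q ≠ formJ Q' :=
  fun e => h (formJ_injOn_reducedForms hD (Finset.mem_coe.mpr ((mem_reducedForms_iff hD).mpr hQ))
    (Finset.mem_coe.mpr ((mem_reducedForms_iff hD).mpr hQ')) e)

/-! ### §6.2 The point `τ₀ = τ_{(1,1,2)}` (`d = -7`, `3` inert): conjugates of discriminant `-63` -/

/-- `j(3τ₀) = j(τ_{(1, 1, 16)})` for `τ₀ = τ_{(1,1,2)}`. [cite: Cox2013, §11.A Thm. 11.2] -/
theorem conj_inf_seven : kleinJ (mulPoint 3 (heegnerTau (1, 1, 2))) = formJ (1, 1, 16) := by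
  have h := mulPoint_three_heegnerTau_of_pos (a := 1) (b := 1) (c := 2) one_pos (by norm_num)
  norm_num at h
  rw [h, ← formJ_eq_kleinJ, formJ_one_eq_of_discr_eq (B := 3) (C := 18) (B' := 1) (C' := 16)
    (by norm_num) (by norm_num)]

/-- `j((τ₀ + 0)/3) = j(τ_{(9, 3, 2)}) = j(τ_{(2, 1, 8)})` for `τ₀ = τ_{(1,1,2)}`. [cite: Cox2013, §11.A Thm. 11.2 and Exercise 11.5] -/
theorem conj_0_seven : kleinJ (divPoint 3 0 (heegnerTau (1, 1, 2))) = formJ (2, 1, 8) := by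
  have h := divPoint_three_heegnerTau_of_pos (a := 1) (b := 1) (c := 2) one_pos (by norm_num) 0
  norm_num at h
  rw [h, ← formJ_eq_kleinJ]
  have e := formJ_eq_formJ_act ⟨9, 3, 2⟩ (by norm_num) (by norm_num [BinQF.disc]) (p := 0) (q := -1)
    (r := 1) (s := 1) (by norm_num)
  simpa [BinQF.act] using e

/-- `j((τ₀ + 1)/3) = j(τ_{(9, -3, 2)}) = j(τ_{(2, -1, 8)})` for `τ₀ = τ_{(1,1,2)}`. [cite: Cox2013, §11.A Thm. 11.2 and Exercise 11.5] -/
theorem conj_1_seven : kleinJ (divPoint 3 1 (heegnerTau (1, 1, 2))) = formJ (2, -1, 8) := by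
  have h := divPoint_three_heegnerTau_of_pos (a := 1) (b := 1) (c := 2) one_pos (by norm_num) 1
  norm_num at h
  rw [h, ← formJ_eq_kleinJ]
  have e := formJ_eq_formJ_act ⟨9, -3, 2⟩ (by norm_num) (by norm_num [BinQF.disc]) (p := 0) (q := -1)
    (r := 1) (s := -1) (by norm_num)
  simpa [BinQF.act] using e

/-- `j((τ₀ + 2)/3) = j(τ_{(9, -9, 4)}) = j(τ_{(4, 1, 4)})` for `τ₀ = τ_{(1,1,2)}`. [cite: Cox2013, §11.A Thm. 11.2 and Exercise 11.5] -/
theorem conj_2_seven : kleinJ (divPoint 3 2 (heegnerTau (1, 1, 2))) = formJ (4, 1, 4) := by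
  have h := divPoint_three_heegnerTau_of_pos (a := 1) (b := 1) (c := 2) one_pos (by norm_num) 2
  norm_num at h
  rw [h, ← formJ_eq_kleinJ]
  have e := formJ_eq_formJ_act ⟨9, -9, 4⟩ (by norm_num) (by norm_num [BinQF.disc]) (p := 0) (q := -1)
    (r := 1) (s := -1) (by norm_num)
  simpa [BinQF.act] using e

/-- **The four level-3 conjugates of `τ_{(1,1,2)}` have pairwise distinct moduli** (they are four
pairwise distinct reduced forms of discriminant `-63`, and `j` separates reduced forms).
[cite: Cox2013, §11.A Thm. 11.2 and §2.A Thm. 2.8] -/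
theorem conj_ne_seven :
    formJ ((1 : ℤ), (1 : ℤ), (16 : ℤ)) ≠ formJ ((2 : ℤ), (1 : ℤ), (8 : ℤ)) ∧
    formJ ((1 : ℤ), (1 : ℤ), (16 : ℤ)) ≠ formJ ((2 : ℤ), (-1 : ℤ), (8 : ℤ)) ∧
    formJ ((1 : ℤ), (1 : ℤ), (16 : ℤ)) ≠ formJ ((4 : ℤ), (1 : ℤ), (4 : ℤ)) ∧
    formJ ((2 : ℤ), (1 : ℤ), (8 : ℤ)) ≠ formJ ((2 : ℤ), (-1 : ℤ), (8 : ℤ)) ∧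
    formJ ((2 : ℤ), (1 : ℤ), (8 : ℤ)) ≠ formJ ((4 : ℤ), (1 : ℤ), (4 : ℤ)) ∧
    formJ ((2 : ℤ), (-1 : ℤ), (8 : ℤ)) ≠ formJ ((4 : ℤ), (1 : ℤ), (4 : ℤ)) := by
  have r0 : discr ((1 : ℤ), (1 : ℤ), (16 : ℤ)) = -63 ∧ (0 : ℤ) < ((1 : ℤ), (1 : ℤ), (16 : ℤ)).1 ∧
      IsPrimitive ((1 : ℤ), (1 : ℤ), (16 : ℤ)) ∧ IsReduced ((1 : ℤ), (1 : ℤ), (16 : ℤ)) :=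
    ⟨by decide +kernel, by norm_num, by decide +kernel, by decide +kernel⟩
  have r1 : discr ((2 : ℤ), (1 : ℤ), (8 : ℤ)) = -63 ∧ (0 : ℤ) < ((2 : ℤ), (1 : ℤ), (8 : ℤ)).1 ∧
      IsPrimitive ((2 : ℤ), (1 : ℤ), (8 : ℤ)) ∧ IsReduced ((2 : ℤ), (1 : ℤ), (8 : ℤ)) :=
    ⟨by decide +kernel, by norm_num, by decide +kernel, by decide +kernel⟩
  have r2 : discr ((2 : ℤ), (-1 : ℤ), (8 : ℤ)) = -63 ∧ (0 : ℤ) < ((2 : ℤ), (-1 : ℤ), (8 : ℤ)).1 ∧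
      IsPrimitive ((2 : ℤ), (-1 : ℤ), (8 : ℤ)) ∧ IsReduced ((2 : ℤ), (-1 : ℤ), (8 : ℤ)) :=
    ⟨by decide +kernel, by norm_num, by decide +kernel, by decide +kernel⟩
  have r3 : discr ((4 : ℤ), (1 : ℤ), (4 : ℤ)) = -63 ∧ (0 : ℤ) < ((4 : ℤ), (1 : ℤ), (4 : ℤ)).1 ∧
      IsPrimitive ((4 : ℤ), (1 : ℤ), (4 : ℤ)) ∧ IsReduced ((4 : ℤ), (1 : ℤ), (4 : ℤ)) :=
    ⟨by decide +kernel, by norm_num, by decide +kernel, by decide +kernel⟩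
  refine ⟨?_, ?_, ?_, ?_, ?_, ?_⟩
  · exact formJ_ne_of_reduced (by norm_num) r0 r1 (by decide)
  · exact formJ_ne_of_reduced (by norm_num) r0 r2 (by decide)
  · exact formJ_ne_of_reduced (by norm_num) r0 r3 (by decide)
  · exact formJ_ne_of_reduced (by norm_num) r1 r2 (by decide)
  · exact formJ_ne_of_reduced (by norm_num) r1 r3 (by decide)
  · exact formJ_ne_of_reduced (by norm_num) r2 r3 (by decide)

/-- **Column = `κ₀₄` × fibre at `y₀ = j(τ_{(1,1,2)}) = -3375`**: for all `x`,
`Φ₃(-3375, x) = κ₀₄ · Φ₃(x, -3375)`. [cite: Cox2013, §11.C Thm. 11.18(ii)] -/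
theorem column_seven (x : ℂ) :
    (((intModularPolynomial 3).map (mapRingHom (Int.castRingHom ℂ))).map (evalRingHom x)).eval (-3375 : ℂ) =
      (((intModularPolynomial 3).coeff 0).coeff 4 : ℂ) *
        (((intModularPolynomial 3).map (mapRingHom (Int.castRingHom ℂ))).map (evalRingHom (-3375 : ℂ))).eval x := by
  have hy : kleinJ (heegnerTau (1, 1, 2)) = -3375 := kleinJ_heegnerTau_neg_seven
  obtain ⟨h01, h02, h03, h12, h13, h23⟩ := conj_ne_seven
  -- the fibre over `y₀`
  have hfib := eval_kleinJ_eq_prod x (heegnerTau (1, 1, 2))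
  rw [hy, conj_inf_seven, conj_0_seven, conj_1_seven, conj_2_seven] at hfib
  -- the reversed relations, as roots of the column quartic
  have hrev : ∀ r ∈ ({formJ ((1 : ℤ), (1 : ℤ), (16 : ℤ)), formJ ((2 : ℤ), (1 : ℤ), (8 : ℤ)), formJ ((2 : ℤ), (-1 : ℤ), (8 : ℤ)), formJ ((4 : ℤ), (1 : ℤ), (4 : ℤ))} : Finset ℂ),
      (((intModularPolynomial 3).coeff 0).coeff 4 : ℂ) * r ^ 4 +
      ((((intModularPolynomial 3).coeff 0).coeff 3 : ℂ) + (((intModularPolynomial 3).coeff 1).coeff 3 : ℂ) * (-3375 : ℂ) +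
          (((intModularPolynomial 3).coeff 2).coeff 3 : ℂ) * (-3375 : ℂ) ^ 2 + (((intModularPolynomial 3).coeff 3).coeff 3 : ℂ) * (-3375 : ℂ) ^ 3) * r ^ 3 +
      ((((intModularPolynomial 3).coeff 0).coeff 2 : ℂ) + (((intModularPolynomial 3).coeff 1).coeff 2 : ℂ) * (-3375 : ℂ) +
          (((intModularPolynomial 3).coeff 2).coeff 2 : ℂ) * (-3375 : ℂ) ^ 2 + (((intModularPolynomial 3).coeff 3).coeff 2 : ℂ) * (-3375 : ℂ) ^ 3) * r ^ 2 +
      ((((intModularPolynomial 3).coeff 0).coeff 1 : ℂ) + (((intModularPolynomial 3).coeff 1).coeff 1 : ℂ) * (-3375 : ℂ) +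
          (((intModularPolynomial 3).coeff 2).coeff 1 : ℂ) * (-3375 : ℂ) ^ 2 + (((intModularPolynomial 3).coeff 3).coeff 1 : ℂ) * (-3375 : ℂ) ^ 3) * r +
      ((((intModularPolynomial 3).coeff 0).coeff 0 : ℂ) + (((intModularPolynomial 3).coeff 1).coeff 0 : ℂ) * (-3375 : ℂ) +
          (((intModularPolynomial 3).coeff 2).coeff 0 : ℂ) * (-3375 : ℂ) ^ 2 + (((intModularPolynomial 3).coeff 3).coeff 0 : ℂ) * (-3375 : ℂ) ^ 3 + (-3375 : ℂ) ^ 4) = 0 := by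
    intro r hr
    simp only [Finset.mem_insert, Finset.mem_singleton] at hr
    have h0 := eval_kleinJ_kleinJ_mulPoint (heegnerTau (1, 1, 2))
    have h1 := eval_kleinJ_kleinJ_divPoint 0 (heegnerTau (1, 1, 2))
    have h2 := eval_kleinJ_kleinJ_divPoint 1 (heegnerTau (1, 1, 2))
    have h3 := eval_kleinJ_kleinJ_divPoint 2 (heegnerTau (1, 1, 2))
    rw [hy, conj_inf_seven, eval_eq_quartic] at h0
    rw [hy, conj_0_seven, eval_eq_quartic] at h1
    rw [hy, conj_1_seven, eval_eq_quartic] at h2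
    rw [hy, conj_2_seven, eval_eq_quartic] at h3
    rcases hr with rfl | rfl | rfl | rfl
    · linear_combination h0
    · linear_combination h1
    · linear_combination h2
    · linear_combination h3
  have hcol := quartic_eq_mul_prod h01 h02 h03 h12 h13 h23 hrev x
  rw [eval_eq_quartic, hfib]
  linear_combination hcol

/-! ### §6.5 The point `τ₀ = τ_{(1,1,5)}` (`d = -19`, `3` inert): conjugates of discriminant `-171` -/

/-- `j(3τ₀) = j(τ_{(1, 1, 43)})` for `τ₀ = τ_{(1,1,5)}`. [cite: Cox2013, §11.A Thm. 11.2] -/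
theorem conj_inf_nineteen : kleinJ (mulPoint 3 (heegnerTau (1, 1, 5))) = formJ (1, 1, 43) := by
  have h := mulPoint_three_heegnerTau_of_pos (a := 1) (b := 1) (c := 5) one_pos (by norm_num)
  norm_num at h
  rw [h, ← formJ_eq_kleinJ, formJ_one_eq_of_discr_eq (B := 3) (C := 45) (B' := 1) (C' := 43)
    (by norm_num) (by norm_num)]

/-- `j((τ₀ + 0)/3) = j(τ_{(9, 3, 5)}) = j(τ_{(5, -3, 9)})` for `τ₀ = τ_{(1,1,5)}`. [cite: Cox2013, §11.A Thm. 11.2 and Exercise 11.5] -/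
theorem conj_0_nineteen : kleinJ (divPoint 3 0 (heegnerTau (1, 1, 5))) = formJ (5, -3, 9) := by
  have h := divPoint_three_heegnerTau_of_pos (a := 1) (b := 1) (c := 5) one_pos (by norm_num) 0
  norm_num at h
  rw [h, ← formJ_eq_kleinJ]
  have e := formJ_eq_formJ_act ⟨9, 3, 5⟩ (by norm_num) (by norm_num [BinQF.disc]) (p := 0) (q := -1)
    (r := 1) (s := 0) (by norm_num)
  simpa [BinQF.act] using e

/-- `j((τ₀ + 1)/3) = j(τ_{(9, -3, 5)}) = j(τ_{(5, 3, 9)})` for `τ₀ = τ_{(1,1,5)}`. [cite: Cox2013, §11.A Thm. 11.2 and Exercise 11.5] -/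
theorem conj_1_nineteen : kleinJ (divPoint 3 1 (heegnerTau (1, 1, 5))) = formJ (5, 3, 9) := by
  have h := divPoint_three_heegnerTau_of_pos (a := 1) (b := 1) (c := 5) one_pos (by norm_num) 1
  norm_num at h
  rw [h, ← formJ_eq_kleinJ]
  have e := formJ_eq_formJ_act ⟨9, -3, 5⟩ (by norm_num) (by norm_num [BinQF.disc]) (p := 0) (q := -1)
    (r := 1) (s := 0) (by norm_num)
  simpa [BinQF.act] using e

/-- `j((τ₀ + 2)/3) = j(τ_{(9, -9, 7)}) = j(τ_{(7, 5, 7)})` for `τ₀ = τ_{(1,1,5)}`. [cite: Cox2013, §11.A Thm. 11.2 and Exercise 11.5] -/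
theorem conj_2_nineteen : kleinJ (divPoint 3 2 (heegnerTau (1, 1, 5))) = formJ (7, 5, 7) := by
  have h := divPoint_three_heegnerTau_of_pos (a := 1) (b := 1) (c := 5) one_pos (by norm_num) 2
  norm_num at h
  rw [h, ← formJ_eq_kleinJ]
  have e := formJ_eq_formJ_act ⟨9, -9, 7⟩ (by norm_num) (by norm_num [BinQF.disc]) (p := -1) (q := 0)
    (r := -1) (s := -1) (by norm_num)
  simpa [BinQF.act] using e

/-- **The four level-3 conjugates of `τ_{(1,1,5)}` have pairwise distinct moduli** (they are four
pairwise distinct reduced forms of discriminant `-171`, and `j` separates reduced forms).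
[cite: Cox2013, §11.A Thm. 11.2 and §2.A Thm. 2.8] -/
theorem conj_ne_nineteen :
    formJ ((1 : ℤ), (1 : ℤ), (43 : ℤ)) ≠ formJ ((5 : ℤ), (-3 : ℤ), (9 : ℤ)) ∧
    formJ ((1 : ℤ), (1 : ℤ), (43 : ℤ)) ≠ formJ ((5 : ℤ), (3 : ℤ), (9 : ℤ)) ∧
    formJ ((1 : ℤ), (1 : ℤ), (43 : ℤ)) ≠ formJ ((7 : ℤ), (5 : ℤ), (7 : ℤ)) ∧
    formJ ((5 : ℤ), (-3 : ℤ), (9 : ℤ)) ≠ formJ ((5 : ℤ), (3 : ℤ), (9 : ℤ)) ∧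
    formJ ((5 : ℤ), (-3 : ℤ), (9 : ℤ)) ≠ formJ ((7 : ℤ), (5 : ℤ), (7 : ℤ)) ∧
    formJ ((5 : ℤ), (3 : ℤ), (9 : ℤ)) ≠ formJ ((7 : ℤ), (5 : ℤ), (7 : ℤ)) := by
  have r0 : discr ((1 : ℤ), (1 : ℤ), (43 : ℤ)) = -171 ∧ (0 : ℤ) < ((1 : ℤ), (1 : ℤ), (43 : ℤ)).1 ∧
      IsPrimitive ((1 : ℤ), (1 : ℤ), (43 : ℤ)) ∧ IsReduced ((1 : ℤ), (1 : ℤ), (43 : ℤ)) :=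
    ⟨by decide +kernel, by norm_num, by decide +kernel, by decide +kernel⟩
  have r1 : discr ((5 : ℤ), (-3 : ℤ), (9 : ℤ)) = -171 ∧ (0 : ℤ) < ((5 : ℤ), (-3 : ℤ), (9 : ℤ)).1 ∧
      IsPrimitive ((5 : ℤ), (-3 : ℤ), (9 : ℤ)) ∧ IsReduced ((5 : ℤ), (-3 : ℤ), (9 : ℤ)) :=
    ⟨by decide +kernel, by norm_num, by decide +kernel, by decide +kernel⟩
  have r2 : discr ((5 : ℤ), (3 : ℤ), (9 : ℤ)) = -171 ∧ (0 : ℤ) < ((5 : ℤ), (3 : ℤ), (9 : ℤ)).1 ∧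
      IsPrimitive ((5 : ℤ), (3 : ℤ), (9 : ℤ)) ∧ IsReduced ((5 : ℤ), (3 : ℤ), (9 : ℤ)) :=
    ⟨by decide +kernel, by norm_num, by decide +kernel, by decide +kernel⟩
  have r3 : discr ((7 : ℤ), (5 : ℤ), (7 : ℤ)) = -171 ∧ (0 : ℤ) < ((7 : ℤ), (5 : ℤ), (7 : ℤ)).1 ∧
      IsPrimitive ((7 : ℤ), (5 : ℤ), (7 : ℤ)) ∧ IsReduced ((7 : ℤ), (5 : ℤ), (7 : ℤ)) :=
    ⟨by decide +kernel, by norm_num, by decide +kernel, by decide +kernel⟩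
  refine ⟨?_, ?_, ?_, ?_, ?_, ?_⟩
  · exact formJ_ne_of_reduced (by norm_num) r0 r1 (by decide)
  · exact formJ_ne_of_reduced (by norm_num) r0 r2 (by decide)
  · exact formJ_ne_of_reduced (by norm_num) r0 r3 (by decide)
  · exact formJ_ne_of_reduced (by norm_num) r1 r2 (by decide)
  · exact formJ_ne_of_reduced (by norm_num) r1 r3 (by decide)
  · exact formJ_ne_of_reduced (by norm_num) r2 r3 (by decide)

/-- **Column = `κ₀₄` × fibre at `y₀ = j(τ_{(1,1,5)}) = -884736`**: for all `x`,
`Φ₃(-884736, x) = κ₀₄ · Φ₃(x, -884736)`. [cite: Cox2013, §11.C Thm. 11.18(ii)] -/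
theorem column_nineteen (x : ℂ) :
    (((intModularPolynomial 3).map (mapRingHom (Int.castRingHom ℂ))).map (evalRingHom x)).eval (-884736 : ℂ) =
      (((intModularPolynomial 3).coeff 0).coeff 4 : ℂ) *
        (((intModularPolynomial 3).map (mapRingHom (Int.castRingHom ℂ))).map (evalRingHom (-884736 : ℂ))).eval x := by
  have hy : kleinJ (heegnerTau (1, 1, 5)) = -884736 := kleinJ_heegnerTau_neg_nineteen
  obtain ⟨h01, h02, h03, h12, h13, h23⟩ := conj_ne_nineteen
  -- the fibre over `y₀`
  have hfib := eval_kleinJ_eq_prod x (heegnerTau (1, 1, 5))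
  rw [hy, conj_inf_nineteen, conj_0_nineteen, conj_1_nineteen, conj_2_nineteen] at hfib
  -- the reversed relations, as roots of the column quartic
  have hrev : ∀ r ∈ ({formJ ((1 : ℤ), (1 : ℤ), (43 : ℤ)), formJ ((5 : ℤ), (-3 : ℤ), (9 : ℤ)), formJ ((5 : ℤ), (3 : ℤ), (9 : ℤ)), formJ ((7 : ℤ), (5 : ℤ), (7 : ℤ))} : Finset ℂ),
      (((intModularPolynomial 3).coeff 0).coeff 4 : ℂ) * r ^ 4 +
      ((((intModularPolynomial 3).coeff 0).coeff 3 : ℂ) + (((intModularPolynomial 3).coeff 1).coeff 3 : ℂ) * (-884736 : ℂ) +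
          (((intModularPolynomial 3).coeff 2).coeff 3 : ℂ) * (-884736 : ℂ) ^ 2 + (((intModularPolynomial 3).coeff 3).coeff 3 : ℂ) * (-884736 : ℂ) ^ 3) * r ^ 3 +
      ((((intModularPolynomial 3).coeff 0).coeff 2 : ℂ) + (((intModularPolynomial 3).coeff 1).coeff 2 : ℂ) * (-884736 : ℂ) +
          (((intModularPolynomial 3).coeff 2).coeff 2 : ℂ) * (-884736 : ℂ) ^ 2 + (((intModularPolynomial 3).coeff 3).coeff 2 : ℂ) * (-884736 : ℂ) ^ 3) * r ^ 2 +
      ((((intModularPolynomial 3).coeff 0).coeff 1 : ℂ) + (((intModularPolynomial 3).coeff 1).coeff 1 : ℂ) * (-884736 : ℂ) +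
          (((intModularPolynomial 3).coeff 2).coeff 1 : ℂ) * (-884736 : ℂ) ^ 2 + (((intModularPolynomial 3).coeff 3).coeff 1 : ℂ) * (-884736 : ℂ) ^ 3) * r +
      ((((intModularPolynomial 3).coeff 0).coeff 0 : ℂ) + (((intModularPolynomial 3).coeff 1).coeff 0 : ℂ) * (-884736 : ℂ) +
          (((intModularPolynomial 3).coeff 2).coeff 0 : ℂ) * (-884736 : ℂ) ^ 2 + (((intModularPolynomial 3).coeff 3).coeff 0 : ℂ) * (-884736 : ℂ) ^ 3 + (-884736 : ℂ) ^ 4) = 0 := by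
    intro r hr
    simp only [Finset.mem_insert, Finset.mem_singleton] at hr
    have h0 := eval_kleinJ_kleinJ_mulPoint (heegnerTau (1, 1, 5))
    have h1 := eval_kleinJ_kleinJ_divPoint 0 (heegnerTau (1, 1, 5))
    have h2 := eval_kleinJ_kleinJ_divPoint 1 (heegnerTau (1, 1, 5))
    have h3 := eval_kleinJ_kleinJ_divPoint 2 (heegnerTau (1, 1, 5))
    rw [hy, conj_inf_nineteen, eval_eq_quartic] at h0
    rw [hy, conj_0_nineteen, eval_eq_quartic] at h1
    rw [hy, conj_1_nineteen, eval_eq_quartic] at h2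
    rw [hy, conj_2_nineteen, eval_eq_quartic] at h3
    rcases hr with rfl | rfl | rfl | rfl
    · linear_combination h0
    · linear_combination h1
    · linear_combination h2
    · linear_combination h3
  have hcol := quartic_eq_mul_prod h01 h02 h03 h12 h13 h23 hrev x
  rw [eval_eq_quartic, hfib]
  linear_combination hcol

/-! ### §6.11 The point `τ₀ = τ_{(1,1,11)}` (`d = -43`, `3` inert): conjugates of discriminant `-387` -/

/-- `j(3τ₀) = j(τ_{(1, 1, 97)})` for `τ₀ = τ_{(1,1,11)}`. [cite: Cox2013, §11.A Thm. 11.2] -/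
theorem conj_inf_fortyThree : kleinJ (mulPoint 3 (heegnerTau (1, 1, 11))) = formJ (1, 1, 97) := by
  have h := mulPoint_three_heegnerTau_of_pos (a := 1) (b := 1) (c := 11) one_pos (by norm_num)
  norm_num at h
  rw [h, ← formJ_eq_kleinJ, formJ_one_eq_of_discr_eq (B := 3) (C := 99) (B' := 1) (C' := 97)
    (by norm_num) (by norm_num)]

/-- `j((τ₀ + 0)/3) = j(τ_{(9, 3, 11)}) = j(τ_{(9, 3, 11)})` for `τ₀ = τ_{(1,1,11)}`. [cite: Cox2013, §11.A Thm. 11.2 and Exercise 11.5] -/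
theorem conj_0_fortyThree : kleinJ (divPoint 3 0 (heegnerTau (1, 1, 11))) = formJ (9, 3, 11) := by
  have h := divPoint_three_heegnerTau_of_pos (a := 1) (b := 1) (c := 11) one_pos (by norm_num) 0
  norm_num at h
  rw [h, ← formJ_eq_kleinJ]

/-- `j((τ₀ + 1)/3) = j(τ_{(9, -3, 11)}) = j(τ_{(9, -3, 11)})` for `τ₀ = τ_{(1,1,11)}`. [cite: Cox2013, §11.A Thm. 11.2 and Exercise 11.5] -/
theorem conj_1_fortyThree : kleinJ (divPoint 3 1 (heegnerTau (1, 1, 11))) = formJ (9, -3, 11) := by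
  have h := divPoint_three_heegnerTau_of_pos (a := 1) (b := 1) (c := 11) one_pos (by norm_num) 1
  norm_num at h
  rw [h, ← formJ_eq_kleinJ]

/-- `j((τ₀ + 2)/3) = j(τ_{(9, -9, 13)}) = j(τ_{(9, 9, 13)})` for `τ₀ = τ_{(1,1,11)}`. [cite: Cox2013, §11.A Thm. 11.2 and Exercise 11.5] -/
theorem conj_2_fortyThree : kleinJ (divPoint 3 2 (heegnerTau (1, 1, 11))) = formJ (9, 9, 13) := by
  have h := divPoint_three_heegnerTau_of_pos (a := 1) (b := 1) (c := 11) one_pos (by norm_num) 2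
  norm_num at h
  rw [h, ← formJ_eq_kleinJ]
  have e := formJ_eq_formJ_act ⟨9, -9, 13⟩ (by norm_num) (by norm_num [BinQF.disc]) (p := -1) (q := -1)
    (r := 0) (s := -1) (by norm_num)
  simpa [BinQF.act] using e

/-- **The four level-3 conjugates of `τ_{(1,1,11)}` have pairwise distinct moduli** (they are four
pairwise distinct reduced forms of discriminant `-387`, and `j` separates reduced forms).
[cite: Cox2013, §11.A Thm. 11.2 and §2.A Thm. 2.8] -/
theorem conj_ne_fortyThree :
    formJ ((1 : ℤ), (1 : ℤ), (97 : ℤ)) ≠ formJ ((9 : ℤ), (3 : ℤ), (11 : ℤ)) ∧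
    formJ ((1 : ℤ), (1 : ℤ), (97 : ℤ)) ≠ formJ ((9 : ℤ), (-3 : ℤ), (11 : ℤ)) ∧
    formJ ((1 : ℤ), (1 : ℤ), (97 : ℤ)) ≠ formJ ((9 : ℤ), (9 : ℤ), (13 : ℤ)) ∧
    formJ ((9 : ℤ), (3 : ℤ), (11 : ℤ)) ≠ formJ ((9 : ℤ), (-3 : ℤ), (11 : ℤ)) ∧
    formJ ((9 : ℤ), (3 : ℤ), (11 : ℤ)) ≠ formJ ((9 : ℤ), (9 : ℤ), (13 : ℤ)) ∧
    formJ ((9 : ℤ), (-3 : ℤ), (11 : ℤ)) ≠ formJ ((9 : ℤ), (9 : ℤ), (13 : ℤ)) := by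
  have r0 : discr ((1 : ℤ), (1 : ℤ), (97 : ℤ)) = -387 ∧ (0 : ℤ) < ((1 : ℤ), (1 : ℤ), (97 : ℤ)).1 ∧
      IsPrimitive ((1 : ℤ), (1 : ℤ), (97 : ℤ)) ∧ IsReduced ((1 : ℤ), (1 : ℤ), (97 : ℤ)) :=
    ⟨by decide +kernel, by norm_num, by decide +kernel, by decide +kernel⟩
  have r1 : discr ((9 : ℤ), (3 : ℤ), (11 : ℤ)) = -387 ∧ (0 : ℤ) < ((9 : ℤ), (3 : ℤ), (11 : ℤ)).1 ∧
      IsPrimitive ((9 : ℤ), (3 : ℤ), (11 : ℤ)) ∧ IsReduced ((9 : ℤ), (3 : ℤ), (11 : ℤ)) :=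
    ⟨by decide +kernel, by norm_num, by decide +kernel, by decide +kernel⟩
  have r2 : discr ((9 : ℤ), (-3 : ℤ), (11 : ℤ)) = -387 ∧ (0 : ℤ) < ((9 : ℤ), (-3 : ℤ), (11 : ℤ)).1 ∧
      IsPrimitive ((9 : ℤ), (-3 : ℤ), (11 : ℤ)) ∧ IsReduced ((9 : ℤ), (-3 : ℤ), (11 : ℤ)) :=
    ⟨by decide +kernel, by norm_num, by decide +kernel, by decide +kernel⟩
  have r3 : discr ((9 : ℤ), (9 : ℤ), (13 : ℤ)) = -387 ∧ (0 : ℤ) < ((9 : ℤ), (9 : ℤ), (13 : ℤ)).1 ∧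
      IsPrimitive ((9 : ℤ), (9 : ℤ), (13 : ℤ)) ∧ IsReduced ((9 : ℤ), (9 : ℤ), (13 : ℤ)) :=
    ⟨by decide +kernel, by norm_num, by decide +kernel, by decide +kernel⟩
  refine ⟨?_, ?_, ?_, ?_, ?_, ?_⟩
  · exact formJ_ne_of_reduced (by norm_num) r0 r1 (by decide)
  · exact formJ_ne_of_reduced (by norm_num) r0 r2 (by decide)
  · exact formJ_ne_of_reduced (by norm_num) r0 r3 (by decide)
  · exact formJ_ne_of_reduced (by norm_num) r1 r2 (by decide)
  · exact formJ_ne_of_reduced (by norm_num) r1 r3 (by decide)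
  · exact formJ_ne_of_reduced (by norm_num) r2 r3 (by decide)

/-- **Column = `κ₀₄` × fibre at `y₀ = j(τ_{(1,1,11)}) = -884736000`**: for all `x`,
`Φ₃(-884736000, x) = κ₀₄ · Φ₃(x, -884736000)`. [cite: Cox2013, §11.C Thm. 11.18(ii)] -/
theorem column_fortyThree (x : ℂ) :
    (((intModularPolynomial 3).map (mapRingHom (Int.castRingHom ℂ))).map (evalRingHom x)).eval (-884736000 : ℂ) =
      (((intModularPolynomial 3).coeff 0).coeff 4 : ℂ) *
        (((intModularPolynomial 3).map (mapRingHom (Int.castRingHom ℂ))).map (evalRingHom (-884736000 : ℂ))).eval x := by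
  have hy : kleinJ (heegnerTau (1, 1, 11)) = -884736000 := kleinJ_heegnerTau_neg_fortyThree
  obtain ⟨h01, h02, h03, h12, h13, h23⟩ := conj_ne_fortyThree
  -- the fibre over `y₀`
  have hfib := eval_kleinJ_eq_prod x (heegnerTau (1, 1, 11))
  rw [hy, conj_inf_fortyThree, conj_0_fortyThree, conj_1_fortyThree, conj_2_fortyThree] at hfib
  -- the reversed relations, as roots of the column quartic
  have hrev : ∀ r ∈ ({formJ ((1 : ℤ), (1 : ℤ), (97 : ℤ)), formJ ((9 : ℤ), (3 : ℤ), (11 : ℤ)), formJ ((9 : ℤ), (-3 : ℤ), (11 : ℤ)), formJ ((9 : ℤ), (9 : ℤ), (13 : ℤ))} : Finset ℂ),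
      (((intModularPolynomial 3).coeff 0).coeff 4 : ℂ) * r ^ 4 +
      ((((intModularPolynomial 3).coeff 0).coeff 3 : ℂ) + (((intModularPolynomial 3).coeff 1).coeff 3 : ℂ) * (-884736000 : ℂ) +
          (((intModularPolynomial 3).coeff 2).coeff 3 : ℂ) * (-884736000 : ℂ) ^ 2 + (((intModularPolynomial 3).coeff 3).coeff 3 : ℂ) * (-884736000 : ℂ) ^ 3) * r ^ 3 +
      ((((intModularPolynomial 3).coeff 0).coeff 2 : ℂ) + (((intModularPolynomial 3).coeff 1).coeff 2 : ℂ) * (-884736000 : ℂ) +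
          (((intModularPolynomial 3).coeff 2).coeff 2 : ℂ) * (-884736000 : ℂ) ^ 2 + (((intModularPolynomial 3).coeff 3).coeff 2 : ℂ) * (-884736000 : ℂ) ^ 3) * r ^ 2 +
      ((((intModularPolynomial 3).coeff 0).coeff 1 : ℂ) + (((intModularPolynomial 3).coeff 1).coeff 1 : ℂ) * (-884736000 : ℂ) +
          (((intModularPolynomial 3).coeff 2).coeff 1 : ℂ) * (-884736000 : ℂ) ^ 2 + (((intModularPolynomial 3).coeff 3).coeff 1 : ℂ) * (-884736000 : ℂ) ^ 3) * r +
      ((((intModularPolynomial 3).coeff 0).coeff 0 : ℂ) + (((intModularPolynomial 3).coeff 1).coeff 0 : ℂ) * (-884736000 : ℂ) +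
          (((intModularPolynomial 3).coeff 2).coeff 0 : ℂ) * (-884736000 : ℂ) ^ 2 + (((intModularPolynomial 3).coeff 3).coeff 0 : ℂ) * (-884736000 : ℂ) ^ 3 + (-884736000 : ℂ) ^ 4) = 0 := by
    intro r hr
    simp only [Finset.mem_insert, Finset.mem_singleton] at hr
    have h0 := eval_kleinJ_kleinJ_mulPoint (heegnerTau (1, 1, 11))
    have h1 := eval_kleinJ_kleinJ_divPoint 0 (heegnerTau (1, 1, 11))
    have h2 := eval_kleinJ_kleinJ_divPoint 1 (heegnerTau (1, 1, 11))
    have h3 := eval_kleinJ_kleinJ_divPoint 2 (heegnerTau (1, 1, 11))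
    rw [hy, conj_inf_fortyThree, eval_eq_quartic] at h0
    rw [hy, conj_0_fortyThree, eval_eq_quartic] at h1
    rw [hy, conj_1_fortyThree, eval_eq_quartic] at h2
    rw [hy, conj_2_fortyThree, eval_eq_quartic] at h3
    rcases hr with rfl | rfl | rfl | rfl
    · linear_combination h0
    · linear_combination h1
    · linear_combination h2
    · linear_combination h3
  have hcol := quartic_eq_mul_prod h01 h02 h03 h12 h13 h23 hrev x
  rw [eval_eq_quartic, hfib]
  linear_combination hcol

/-! ### §6.17 The point `τ₀ = τ_{(1,1,17)}` (`d = -67`, `3` inert): conjugates of discriminant `-603` -/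

/-- `j(3τ₀) = j(τ_{(1, 1, 151)})` for `τ₀ = τ_{(1,1,17)}`. [cite: Cox2013, §11.A Thm. 11.2] -/
theorem conj_inf_sixtySeven : kleinJ (mulPoint 3 (heegnerTau (1, 1, 17))) = formJ (1, 1, 151) := by
  have h := mulPoint_three_heegnerTau_of_pos (a := 1) (b := 1) (c := 17) one_pos (by norm_num)
  norm_num at h
  rw [h, ← formJ_eq_kleinJ, formJ_one_eq_of_discr_eq (B := 3) (C := 153) (B' := 1) (C' := 151)
    (by norm_num) (by norm_num)]

/-- `j((τ₀ + 0)/3) = j(τ_{(9, 3, 17)}) = j(τ_{(9, 3, 17)})` for `τ₀ = τ_{(1,1,17)}`. [cite: Cox2013, §11.A Thm. 11.2 and Exercise 11.5] -/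
theorem conj_0_sixtySeven : kleinJ (divPoint 3 0 (heegnerTau (1, 1, 17))) = formJ (9, 3, 17) := by
  have h := divPoint_three_heegnerTau_of_pos (a := 1) (b := 1) (c := 17) one_pos (by norm_num) 0
  norm_num at h
  rw [h, ← formJ_eq_kleinJ]

/-- `j((τ₀ + 1)/3) = j(τ_{(9, -3, 17)}) = j(τ_{(9, -3, 17)})` for `τ₀ = τ_{(1,1,17)}`. [cite: Cox2013, §11.A Thm. 11.2 and Exercise 11.5] -/
theorem conj_1_sixtySeven : kleinJ (divPoint 3 1 (heegnerTau (1, 1, 17))) = formJ (9, -3, 17) := by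
  have h := divPoint_three_heegnerTau_of_pos (a := 1) (b := 1) (c := 17) one_pos (by norm_num) 1
  norm_num at h
  rw [h, ← formJ_eq_kleinJ]

/-- `j((τ₀ + 2)/3) = j(τ_{(9, -9, 19)}) = j(τ_{(9, 9, 19)})` for `τ₀ = τ_{(1,1,17)}`. [cite: Cox2013, §11.A Thm. 11.2 and Exercise 11.5] -/
theorem conj_2_sixtySeven : kleinJ (divPoint 3 2 (heegnerTau (1, 1, 17))) = formJ (9, 9, 19) := by
  have h := divPoint_three_heegnerTau_of_pos (a := 1) (b := 1) (c := 17) one_pos (by norm_num) 2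
  norm_num at h
  rw [h, ← formJ_eq_kleinJ]
  have e := formJ_eq_formJ_act ⟨9, -9, 19⟩ (by norm_num) (by norm_num [BinQF.disc]) (p := -1) (q := -1)
    (r := 0) (s := -1) (by norm_num)
  simpa [BinQF.act] using e

/-- **The four level-3 conjugates of `τ_{(1,1,17)}` have pairwise distinct moduli** (they are four
pairwise distinct reduced forms of discriminant `-603`, and `j` separates reduced forms).
[cite: Cox2013, §11.A Thm. 11.2 and §2.A Thm. 2.8] -/
theorem conj_ne_sixtySeven :
    formJ ((1 : ℤ), (1 : ℤ), (151 : ℤ)) ≠ formJ ((9 : ℤ), (3 : ℤ), (17 : ℤ)) ∧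
    formJ ((1 : ℤ), (1 : ℤ), (151 : ℤ)) ≠ formJ ((9 : ℤ), (-3 : ℤ), (17 : ℤ)) ∧
    formJ ((1 : ℤ), (1 : ℤ), (151 : ℤ)) ≠ formJ ((9 : ℤ), (9 : ℤ), (19 : ℤ)) ∧
    formJ ((9 : ℤ), (3 : ℤ), (17 : ℤ)) ≠ formJ ((9 : ℤ), (-3 : ℤ), (17 : ℤ)) ∧
    formJ ((9 : ℤ), (3 : ℤ), (17 : ℤ)) ≠ formJ ((9 : ℤ), (9 : ℤ), (19 : ℤ)) ∧
    formJ ((9 : ℤ), (-3 : ℤ), (17 : ℤ)) ≠ formJ ((9 : ℤ), (9 : ℤ), (19 : ℤ)) := by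
  have r0 : discr ((1 : ℤ), (1 : ℤ), (151 : ℤ)) = -603 ∧ (0 : ℤ) < ((1 : ℤ), (1 : ℤ), (151 : ℤ)).1 ∧
      IsPrimitive ((1 : ℤ), (1 : ℤ), (151 : ℤ)) ∧ IsReduced ((1 : ℤ), (1 : ℤ), (151 : ℤ)) :=
    ⟨by decide +kernel, by norm_num, by decide +kernel, by decide +kernel⟩
  have r1 : discr ((9 : ℤ), (3 : ℤ), (17 : ℤ)) = -603 ∧ (0 : ℤ) < ((9 : ℤ), (3 : ℤ), (17 : ℤ)).1 ∧
      IsPrimitive ((9 : ℤ), (3 : ℤ), (17 : ℤ)) ∧ IsReduced ((9 : ℤ), (3 : ℤ), (17 : ℤ)) :=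
    ⟨by decide +kernel, by norm_num, by decide +kernel, by decide +kernel⟩
  have r2 : discr ((9 : ℤ), (-3 : ℤ), (17 : ℤ)) = -603 ∧ (0 : ℤ) < ((9 : ℤ), (-3 : ℤ), (17 : ℤ)).1 ∧
      IsPrimitive ((9 : ℤ), (-3 : ℤ), (17 : ℤ)) ∧ IsReduced ((9 : ℤ), (-3 : ℤ), (17 : ℤ)) :=
    ⟨by decide +kernel, by norm_num, by decide +kernel, by decide +kernel⟩
  have r3 : discr ((9 : ℤ), (9 : ℤ), (19 : ℤ)) = -603 ∧ (0 : ℤ) < ((9 : ℤ), (9 : ℤ), (19 : ℤ)).1 ∧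
      IsPrimitive ((9 : ℤ), (9 : ℤ), (19 : ℤ)) ∧ IsReduced ((9 : ℤ), (9 : ℤ), (19 : ℤ)) :=
    ⟨by decide +kernel, by norm_num, by decide +kernel, by decide +kernel⟩
  refine ⟨?_, ?_, ?_, ?_, ?_, ?_⟩
  · exact formJ_ne_of_reduced (by norm_num) r0 r1 (by decide)
  · exact formJ_ne_of_reduced (by norm_num) r0 r2 (by decide)
  · exact formJ_ne_of_reduced (by norm_num) r0 r3 (by decide)
  · exact formJ_ne_of_reduced (by norm_num) r1 r2 (by decide)
  · exact formJ_ne_of_reduced (by norm_num) r1 r3 (by decide)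
  · exact formJ_ne_of_reduced (by norm_num) r2 r3 (by decide)

/-- **Column = `κ₀₄` × fibre at `y₀ = j(τ_{(1,1,17)}) = -147197952000`**: for all `x`,
`Φ₃(-147197952000, x) = κ₀₄ · Φ₃(x, -147197952000)`. [cite: Cox2013, §11.C Thm. 11.18(ii)] -/
theorem column_sixtySeven (x : ℂ) :
    (((intModularPolynomial 3).map (mapRingHom (Int.castRingHom ℂ))).map (evalRingHom x)).eval (-147197952000 : ℂ) =
      (((intModularPolynomial 3).coeff 0).coeff 4 : ℂ) *
        (((intModularPolynomial 3).map (mapRingHom (Int.castRingHom ℂ))).map (evalRingHom (-147197952000 : ℂ))).eval x := by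
  have hy : kleinJ (heegnerTau (1, 1, 17)) = -147197952000 := kleinJ_heegnerTau_neg_sixtySeven
  obtain ⟨h01, h02, h03, h12, h13, h23⟩ := conj_ne_sixtySeven
  -- the fibre over `y₀`
  have hfib := eval_kleinJ_eq_prod x (heegnerTau (1, 1, 17))
  rw [hy, conj_inf_sixtySeven, conj_0_sixtySeven, conj_1_sixtySeven, conj_2_sixtySeven] at hfib
  -- the reversed relations, as roots of the column quartic
  have hrev : ∀ r ∈ ({formJ ((1 : ℤ), (1 : ℤ), (151 : ℤ)), formJ ((9 : ℤ), (3 : ℤ), (17 : ℤ)), formJ ((9 : ℤ), (-3 : ℤ), (17 : ℤ)), formJ ((9 : ℤ), (9 : ℤ), (19 : ℤ))} : Finset ℂ),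
      (((intModularPolynomial 3).coeff 0).coeff 4 : ℂ) * r ^ 4 +
      ((((intModularPolynomial 3).coeff 0).coeff 3 : ℂ) + (((intModularPolynomial 3).coeff 1).coeff 3 : ℂ) * (-147197952000 : ℂ) +
          (((intModularPolynomial 3).coeff 2).coeff 3 : ℂ) * (-147197952000 : ℂ) ^ 2 + (((intModularPolynomial 3).coeff 3).coeff 3 : ℂ) * (-147197952000 : ℂ) ^ 3) * r ^ 3 +
      ((((intModularPolynomial 3).coeff 0).coeff 2 : ℂ) + (((intModularPolynomial 3).coeff 1).coeff 2 : ℂ) * (-147197952000 : ℂ) +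
          (((intModularPolynomial 3).coeff 2).coeff 2 : ℂ) * (-147197952000 : ℂ) ^ 2 + (((intModularPolynomial 3).coeff 3).coeff 2 : ℂ) * (-147197952000 : ℂ) ^ 3) * r ^ 2 +
      ((((intModularPolynomial 3).coeff 0).coeff 1 : ℂ) + (((intModularPolynomial 3).coeff 1).coeff 1 : ℂ) * (-147197952000 : ℂ) +
          (((intModularPolynomial 3).coeff 2).coeff 1 : ℂ) * (-147197952000 : ℂ) ^ 2 + (((intModularPolynomial 3).coeff 3).coeff 1 : ℂ) * (-147197952000 : ℂ) ^ 3) * r +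
      ((((intModularPolynomial 3).coeff 0).coeff 0 : ℂ) + (((intModularPolynomial 3).coeff 1).coeff 0 : ℂ) * (-147197952000 : ℂ) +
          (((intModularPolynomial 3).coeff 2).coeff 0 : ℂ) * (-147197952000 : ℂ) ^ 2 + (((intModularPolynomial 3).coeff 3).coeff 0 : ℂ) * (-147197952000 : ℂ) ^ 3 + (-147197952000 : ℂ) ^ 4) = 0 := by
    intro r hr
    simp only [Finset.mem_insert, Finset.mem_singleton] at hr
    have h0 := eval_kleinJ_kleinJ_mulPoint (heegnerTau (1, 1, 17))
    have h1 := eval_kleinJ_kleinJ_divPoint 0 (heegnerTau (1, 1, 17))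
    have h2 := eval_kleinJ_kleinJ_divPoint 1 (heegnerTau (1, 1, 17))
    have h3 := eval_kleinJ_kleinJ_divPoint 2 (heegnerTau (1, 1, 17))
    rw [hy, conj_inf_sixtySeven, eval_eq_quartic] at h0
    rw [hy, conj_0_sixtySeven, eval_eq_quartic] at h1
    rw [hy, conj_1_sixtySeven, eval_eq_quartic] at h2
    rw [hy, conj_2_sixtySeven, eval_eq_quartic] at h3
    rcases hr with rfl | rfl | rfl | rfl
    · linear_combination h0
    · linear_combination h1
    · linear_combination h2
    · linear_combination h3
  have hcol := quartic_eq_mul_prod h01 h02 h03 h12 h13 h23 hrev x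
  rw [eval_eq_quartic, hfib]
  linear_combination hcol

/-! ### §6.41 The point `τ₀ = τ_{(1,1,41)}` (`d = -163`, `3` inert): conjugates of discriminant `-1467` -/

/-- `j(3τ₀) = j(τ_{(1, 1, 367)})` for `τ₀ = τ_{(1,1,41)}`. [cite: Cox2013, §11.A Thm. 11.2] -/
theorem conj_inf_oneSixtyThree : kleinJ (mulPoint 3 (heegnerTau (1, 1, 41))) = formJ (1, 1, 367) := by
  have h := mulPoint_three_heegnerTau_of_pos (a := 1) (b := 1) (c := 41) one_pos (by norm_num)
  norm_num at h
  rw [h, ← formJ_eq_kleinJ, formJ_one_eq_of_discr_eq (B := 3) (C := 369) (B' := 1) (C' := 367)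
    (by norm_num) (by norm_num)]

/-- `j((τ₀ + 0)/3) = j(τ_{(9, 3, 41)}) = j(τ_{(9, 3, 41)})` for `τ₀ = τ_{(1,1,41)}`. [cite: Cox2013, §11.A Thm. 11.2 and Exercise 11.5] -/
theorem conj_0_oneSixtyThree : kleinJ (divPoint 3 0 (heegnerTau (1, 1, 41))) = formJ (9, 3, 41) := by
  have h := divPoint_three_heegnerTau_of_pos (a := 1) (b := 1) (c := 41) one_pos (by norm_num) 0
  norm_num at h
  rw [h, ← formJ_eq_kleinJ]

/-- `j((τ₀ + 1)/3) = j(τ_{(9, -3, 41)}) = j(τ_{(9, -3, 41)})` for `τ₀ = τ_{(1,1,41)}`. [cite: Cox2013, §11.A Thm. 11.2 and Exercise 11.5] -/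
theorem conj_1_oneSixtyThree : kleinJ (divPoint 3 1 (heegnerTau (1, 1, 41))) = formJ (9, -3, 41) := by
  have h := divPoint_three_heegnerTau_of_pos (a := 1) (b := 1) (c := 41) one_pos (by norm_num) 1
  norm_num at h
  rw [h, ← formJ_eq_kleinJ]

/-- `j((τ₀ + 2)/3) = j(τ_{(9, -9, 43)}) = j(τ_{(9, 9, 43)})` for `τ₀ = τ_{(1,1,41)}`. [cite: Cox2013, §11.A Thm. 11.2 and Exercise 11.5] -/
theorem conj_2_oneSixtyThree : kleinJ (divPoint 3 2 (heegnerTau (1, 1, 41))) = formJ (9, 9, 43) := by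
  have h := divPoint_three_heegnerTau_of_pos (a := 1) (b := 1) (c := 41) one_pos (by norm_num) 2
  norm_num at h
  rw [h, ← formJ_eq_kleinJ]
  have e := formJ_eq_formJ_act ⟨9, -9, 43⟩ (by norm_num) (by norm_num [BinQF.disc]) (p := -1) (q := -1)
    (r := 0) (s := -1) (by norm_num)
  simpa [BinQF.act] using e

/-- **The four level-3 conjugates of `τ_{(1,1,41)}` have pairwise distinct moduli** (they are four
pairwise distinct reduced forms of discriminant `-1467`, and `j` separates reduced forms).
[cite: Cox2013, §11.A Thm. 11.2 and §2.A Thm. 2.8] -/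
theorem conj_ne_oneSixtyThree :
    formJ ((1 : ℤ), (1 : ℤ), (367 : ℤ)) ≠ formJ ((9 : ℤ), (3 : ℤ), (41 : ℤ)) ∧
    formJ ((1 : ℤ), (1 : ℤ), (367 : ℤ)) ≠ formJ ((9 : ℤ), (-3 : ℤ), (41 : ℤ)) ∧
    formJ ((1 : ℤ), (1 : ℤ), (367 : ℤ)) ≠ formJ ((9 : ℤ), (9 : ℤ), (43 : ℤ)) ∧
    formJ ((9 : ℤ), (3 : ℤ), (41 : ℤ)) ≠ formJ ((9 : ℤ), (-3 : ℤ), (41 : ℤ)) ∧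
    formJ ((9 : ℤ), (3 : ℤ), (41 : ℤ)) ≠ formJ ((9 : ℤ), (9 : ℤ), (43 : ℤ)) ∧
    formJ ((9 : ℤ), (-3 : ℤ), (41 : ℤ)) ≠ formJ ((9 : ℤ), (9 : ℤ), (43 : ℤ)) := by
  have r0 : discr ((1 : ℤ), (1 : ℤ), (367 : ℤ)) = -1467 ∧ (0 : ℤ) < ((1 : ℤ), (1 : ℤ), (367 : ℤ)).1 ∧
      IsPrimitive ((1 : ℤ), (1 : ℤ), (367 : ℤ)) ∧ IsReduced ((1 : ℤ), (1 : ℤ), (367 : ℤ)) :=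
    ⟨by decide +kernel, by norm_num, by decide +kernel, by decide +kernel⟩
  have r1 : discr ((9 : ℤ), (3 : ℤ), (41 : ℤ)) = -1467 ∧ (0 : ℤ) < ((9 : ℤ), (3 : ℤ), (41 : ℤ)).1 ∧
      IsPrimitive ((9 : ℤ), (3 : ℤ), (41 : ℤ)) ∧ IsReduced ((9 : ℤ), (3 : ℤ), (41 : ℤ)) :=
    ⟨by decide +kernel, by norm_num, by decide +kernel, by decide +kernel⟩
  have r2 : discr ((9 : ℤ), (-3 : ℤ), (41 : ℤ)) = -1467 ∧ (0 : ℤ) < ((9 : ℤ), (-3 : ℤ), (41 : ℤ)).1 ∧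
      IsPrimitive ((9 : ℤ), (-3 : ℤ), (41 : ℤ)) ∧ IsReduced ((9 : ℤ), (-3 : ℤ), (41 : ℤ)) :=
    ⟨by decide +kernel, by norm_num, by decide +kernel, by decide +kernel⟩
  have r3 : discr ((9 : ℤ), (9 : ℤ), (43 : ℤ)) = -1467 ∧ (0 : ℤ) < ((9 : ℤ), (9 : ℤ), (43 : ℤ)).1 ∧
      IsPrimitive ((9 : ℤ), (9 : ℤ), (43 : ℤ)) ∧ IsReduced ((9 : ℤ), (9 : ℤ), (43 : ℤ)) :=
    ⟨by decide +kernel, by norm_num, by decide +kernel, by decide +kernel⟩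
  refine ⟨?_, ?_, ?_, ?_, ?_, ?_⟩
  · exact formJ_ne_of_reduced (by norm_num) r0 r1 (by decide)
  · exact formJ_ne_of_reduced (by norm_num) r0 r2 (by decide)
  · exact formJ_ne_of_reduced (by norm_num) r0 r3 (by decide)
  · exact formJ_ne_of_reduced (by norm_num) r1 r2 (by decide)
  · exact formJ_ne_of_reduced (by norm_num) r1 r3 (by decide)
  · exact formJ_ne_of_reduced (by norm_num) r2 r3 (by decide)

/-- **Column = `κ₀₄` × fibre at `y₀ = j(τ_{(1,1,41)}) = -262537412640768000`**: for all `x`,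
`Φ₃(-262537412640768000, x) = κ₀₄ · Φ₃(x, -262537412640768000)`. [cite: Cox2013, §11.C Thm. 11.18(ii)] -/
theorem column_oneSixtyThree (x : ℂ) :
    (((intModularPolynomial 3).map (mapRingHom (Int.castRingHom ℂ))).map (evalRingHom x)).eval (-262537412640768000 : ℂ) =
      (((intModularPolynomial 3).coeff 0).coeff 4 : ℂ) *
        (((intModularPolynomial 3).map (mapRingHom (Int.castRingHom ℂ))).map (evalRingHom (-262537412640768000 : ℂ))).eval x := by
  have hy : kleinJ (heegnerTau (1, 1, 41)) = -262537412640768000 := kleinJ_heegnerTau_neg_oneSixtyThree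
  obtain ⟨h01, h02, h03, h12, h13, h23⟩ := conj_ne_oneSixtyThree
  -- the fibre over `y₀`
  have hfib := eval_kleinJ_eq_prod x (heegnerTau (1, 1, 41))
  rw [hy, conj_inf_oneSixtyThree, conj_0_oneSixtyThree, conj_1_oneSixtyThree, conj_2_oneSixtyThree] at hfib
  -- the reversed relations, as roots of the column quartic
  have hrev : ∀ r ∈ ({formJ ((1 : ℤ), (1 : ℤ), (367 : ℤ)), formJ ((9 : ℤ), (3 : ℤ), (41 : ℤ)), formJ ((9 : ℤ), (-3 : ℤ), (41 : ℤ)), formJ ((9 : ℤ), (9 : ℤ), (43 : ℤ))} : Finset ℂ),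
      (((intModularPolynomial 3).coeff 0).coeff 4 : ℂ) * r ^ 4 +
      ((((intModularPolynomial 3).coeff 0).coeff 3 : ℂ) + (((intModularPolynomial 3).coeff 1).coeff 3 : ℂ) * (-262537412640768000 : ℂ) +
          (((intModularPolynomial 3).coeff 2).coeff 3 : ℂ) * (-262537412640768000 : ℂ) ^ 2 + (((intModularPolynomial 3).coeff 3).coeff 3 : ℂ) * (-262537412640768000 : ℂ) ^ 3) * r ^ 3 +
      ((((intModularPolynomial 3).coeff 0).coeff 2 : ℂ) + (((intModularPolynomial 3).coeff 1).coeff 2 : ℂ) * (-262537412640768000 : ℂ) +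
          (((intModularPolynomial 3).coeff 2).coeff 2 : ℂ) * (-262537412640768000 : ℂ) ^ 2 + (((intModularPolynomial 3).coeff 3).coeff 2 : ℂ) * (-262537412640768000 : ℂ) ^ 3) * r ^ 2 +
      ((((intModularPolynomial 3).coeff 0).coeff 1 : ℂ) + (((intModularPolynomial 3).coeff 1).coeff 1 : ℂ) * (-262537412640768000 : ℂ) +
          (((intModularPolynomial 3).coeff 2).coeff 1 : ℂ) * (-262537412640768000 : ℂ) ^ 2 + (((intModularPolynomial 3).coeff 3).coeff 1 : ℂ) * (-262537412640768000 : ℂ) ^ 3) * r +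
      ((((intModularPolynomial 3).coeff 0).coeff 0 : ℂ) + (((intModularPolynomial 3).coeff 1).coeff 0 : ℂ) * (-262537412640768000 : ℂ) +
          (((intModularPolynomial 3).coeff 2).coeff 0 : ℂ) * (-262537412640768000 : ℂ) ^ 2 + (((intModularPolynomial 3).coeff 3).coeff 0 : ℂ) * (-262537412640768000 : ℂ) ^ 3 + (-262537412640768000 : ℂ) ^ 4) = 0 := by
    intro r hr
    simp only [Finset.mem_insert, Finset.mem_singleton] at hr
    have h0 := eval_kleinJ_kleinJ_mulPoint (heegnerTau (1, 1, 41))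
    have h1 := eval_kleinJ_kleinJ_divPoint 0 (heegnerTau (1, 1, 41))
    have h2 := eval_kleinJ_kleinJ_divPoint 1 (heegnerTau (1, 1, 41))
    have h3 := eval_kleinJ_kleinJ_divPoint 2 (heegnerTau (1, 1, 41))
    rw [hy, conj_inf_oneSixtyThree, eval_eq_quartic] at h0
    rw [hy, conj_0_oneSixtyThree, eval_eq_quartic] at h1
    rw [hy, conj_1_oneSixtyThree, eval_eq_quartic] at h2
    rw [hy, conj_2_oneSixtyThree, eval_eq_quartic] at h3
    rcases hr with rfl | rfl | rfl | rfl
    · linear_combination h0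
    · linear_combination h1
    · linear_combination h2
    · linear_combination h3
  have hcol := quartic_eq_mul_prod h01 h02 h03 h12 h13 h23 hrev x
  rw [eval_eq_quartic, hfib]
  linear_combination hcol

/-! ### §7 Globalisation: `Φ₃(y, x) = κ₀₄ Φ₃(x, y)` for all `x, y`, and `κ₀₄ = 1` -/

/-- The five special values are pairwise distinct. [cite: Cox2013, §12.C table (12.20)] -/
theorem card_specialValues :
    (({-3375, -884736, -884736000, -147197952000, -262537412640768000} : Finset ℂ)).card = 5 := by
  rw [Finset.card_insert_of_notMem (by norm_num), Finset.card_insert_of_notMem (by norm_num),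
    Finset.card_insert_of_notMem (by norm_num), Finset.card_pair (by norm_num)]

/-- **`Φ₃(y, x) = κ₀₄ · Φ₃(x, y)` for all `x, y ∈ ℂ`.** For fixed `x` the difference is a polynomial of degree
`≤ 4` in `y` vanishing at the five special values. [cite: Cox2013, §11.C Thm. 11.18(ii)] -/
theorem eval_swap_eq_mul (x y : ℂ) :
    (((intModularPolynomial 3).map (mapRingHom (Int.castRingHom ℂ))).map (evalRingHom x)).eval y =
      (((intModularPolynomial 3).coeff 0).coeff 4 : ℂ) *
        (((intModularPolynomial 3).map (mapRingHom (Int.castRingHom ℂ))).map (evalRingHom y)).eval x := by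
  -- coefficients (in `y`) of the difference, for this fixed `x`
  set e : ℕ → ℂ := fun n =>
    (∑ m ∈ Finset.range 5, ((((intModularPolynomial 3).coeff n).coeff m : ℤ) : ℂ) * x ^ m) -
      (((intModularPolynomial 3).coeff 0).coeff 4 : ℂ) *
        (∑ m ∈ Finset.range 5, ((((intModularPolynomial 3).coeff m).coeff n : ℤ) : ℂ) * x ^ m) with he
  have hdiff : ∀ y' : ℂ,
      (((intModularPolynomial 3).map (mapRingHom (Int.castRingHom ℂ))).map (evalRingHom x)).eval y' -
        (((intModularPolynomial 3).coeff 0).coeff 4 : ℂ) *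
          (((intModularPolynomial 3).map (mapRingHom (Int.castRingHom ℂ))).map (evalRingHom y')).eval x =
      ∑ n ∈ Finset.range 5, e n * y' ^ n := by
    intro y'
    rw [eval_eq_sum, eval_eq_sum]
    simp only [he, Finset.sum_range_succ, Finset.sum_range_zero]
    ring
  have hroots : ∀ y' ∈ (({-3375, -884736, -884736000, -147197952000, -262537412640768000} : Finset ℂ)), ∑ n ∈ Finset.range 5, e n * y' ^ n = 0 := by
    intro y' hy'
    rw [← hdiff]
    simp only [Finset.mem_insert, Finset.mem_singleton] at hy'
    rcases hy' with rfl | rfl | rfl | rfl | rfl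
    · rw [column_seven]; ring
    · rw [column_nineteen]; ring
    · rw [column_fortyThree]; ring
    · rw [column_sixtySeven]; ring
    · rw [column_oneSixtyThree]; ring
  have hz := coeff_eq_zero_of_sum_eq_zero e _ card_specialValues.ge hroots
  have := hdiff y
  rw [Finset.sum_eq_zero (fun n hn => by rw [hz n (Finset.mem_range.mp hn), zero_mul])] at this
  linear_combination this

/-- **Coefficient identity**: `κ_{n,m} = κ₀₄ · κ_{m,n}` for all `m, n`. [cite: Cox2013, §11.C Thm. 11.18(ii)] -/
theorem coeff_coeff_swap_eq_mul (m n : ℕ) :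
    (((intModularPolynomial 3).coeff n).coeff m : ℂ) =
      (((intModularPolynomial 3).coeff 0).coeff 4 : ℂ) * (((intModularPolynomial 3).coeff m).coeff n : ℂ) := by
  -- both sides vanish beyond degree 4
  by_cases hm : 5 ≤ m
  · rw [coeff_coeff_eq_zero_of_five_le n hm, coeff_eq_zero_of_five_le hm]; simp
  by_cases hn : 5 ≤ n
  · rw [coeff_eq_zero_of_five_le hn, coeff_coeff_eq_zero_of_five_le m hn]; simp
  push Not at hm hn
  -- the bivariate function identity, read coefficientwise: first in `y`, then in `x`
  set a : ℕ → ℕ → ℂ := fun m' n' =>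
    ((((intModularPolynomial 3).coeff n').coeff m' : ℤ) : ℂ) -
      (((intModularPolynomial 3).coeff 0).coeff 4 : ℂ) * ((((intModularPolynomial 3).coeff m').coeff n' : ℤ) : ℂ) with ha
  have hxy : ∀ x y : ℂ, ∑ n' ∈ Finset.range 5, (∑ m' ∈ Finset.range 5, a m' n' * x ^ m') * y ^ n' = 0 := by
    intro x y
    have h := eval_swap_eq_mul x y
    rw [eval_eq_sum, eval_eq_sum] at h
    simp only [ha, Finset.sum_range_succ, Finset.sum_range_zero] at h ⊢
    linear_combination h
  have s5 : (5 : ℕ) ≤ (({0, 1, 2, 3, 4} : Finset ℂ)).card := by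
    rw [Finset.card_insert_of_notMem (by norm_num), Finset.card_insert_of_notMem (by norm_num),
      Finset.card_insert_of_notMem (by norm_num), Finset.card_pair (by norm_num)]
  have hx : ∀ x : ℂ, ∀ n' < 5, ∑ m' ∈ Finset.range 5, a m' n' * x ^ m' = 0 := fun x =>
    coeff_eq_zero_of_sum_eq_zero (fun n' => ∑ m' ∈ Finset.range 5, a m' n' * x ^ m') _ s5 (fun y _ => hxy x y)
  have hmn : a m n = 0 :=
    coeff_eq_zero_of_sum_eq_zero (fun m' => a m' n) _ s5 (fun x _ => hx x n hn) m hm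
  simp only [ha] at hmn
  linear_combination hmn

/-- **`κ₀₄ = 1`**: the coefficient of `Y⁴` in `Φ₃(X, Y)` is `1` (from `κ₃₃ = κ₀₄ κ₃₃`, `κ₃₃ = −1`).
[cite: Cox2013, §11.C Thm. 11.18(ii)] -/
theorem coeff_zero_coeff_four : ((intModularPolynomial 3).coeff 0).coeff 4 = 1 := by
  have h := coeff_coeff_swap_eq_mul 3 3
  rw [coeff_three_three] at h
  push_cast at h
  have h1 : ((((intModularPolynomial 3).coeff 0).coeff 4 : ℤ) : ℂ) = 1 := by linear_combination h
  exact_mod_cast h1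

end ModularPolynomialThree

open ModularPolynomialThree in
/-- **Symmetry of the level-3 modular equation, coefficientwise**: `κ_{m,n} = κ_{n,m}`, i.e.
`Φ₃(X, Y) = Φ₃(Y, X)` in `ℤ[X, Y]`. [cite: Cox2013, §11.C Thm. 11.18(ii)] -/
theorem intModularPolynomial_three_coeff_symm (m n : ℕ) :
    ((intModularPolynomial 3).coeff m).coeff n = ((intModularPolynomial 3).coeff n).coeff m := by
  have h := coeff_coeff_swap_eq_mul m n
  rw [coeff_zero_coeff_four] at h
  push_cast at h
  rw [one_mul] at h
  exact_mod_cast h.symm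

open ModularPolynomialThree in
/-- **Symmetry of the level-3 modular equation, pointwise**: `Φ₃(x, y) = Φ₃(y, x)` for all `x, y ∈ ℂ`.
[cite: Cox2013, §11.C Thm. 11.18(ii)] -/
theorem intModularPolynomial_three_eval_symm (x y : ℂ) :
    (((intModularPolynomial 3).map (mapRingHom (Int.castRingHom ℂ))).map (evalRingHom y)).eval x =
      (((intModularPolynomial 3).map (mapRingHom (Int.castRingHom ℂ))).map (evalRingHom x)).eval y := by
  have h := eval_swap_eq_mul x y
  rw [coeff_zero_coeff_four] at h
  push_cast at h
  rw [one_mul] at h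
  exact h.symm

open ModularPolynomialThree in
/-- **`Φ₃(j(τ), j(3τ)) = 0` as a FIBRE statement**: `j(τ)` is a root of `X ↦ Φ₃(X, j(3τ))`, and symmetrically
`Φ₃(x, y) = 0 ↔ Φ₃(y, x) = 0`. [cite: Cox2013, §11.C Thm. 11.18(ii)] -/
theorem intModularPolynomial_three_eval_eq_zero_comm (x y : ℂ) :
    (((intModularPolynomial 3).map (mapRingHom (Int.castRingHom ℂ))).map (evalRingHom y)).eval x = 0 ↔
      (((intModularPolynomial 3).map (mapRingHom (Int.castRingHom ℂ))).map (evalRingHom x)).eval y = 0 := by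
  rw [intModularPolynomial_three_eval_symm]

end Literature.NumberTheory.EllipticCurves

end
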